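import Mathlib
import Summits.Ventures.PercRepro2.OneEdge
import Summits.Ventures.PercRepro2.KPrimeReduction
import Summits.Ventures.PercRepro2.KPrimeBase
import Summits.Ventures.PercRepro2.KPrimeSure

/-!
# Resolving an edge from the root of `a₂` into `a₁` or into `v`, and flip invariance
(blind cell PercRepro2, mine-c g32; `conjectures/MINE-C.md` §41.3)

Part II of the kernel form of the induction frame «`(STEP′) ⟹ (K′)`» (`KPrimeInduction.lean`).
The `a₂`-frontier exploration resolves the edges at the root with the other end outside
`{a₁, v}`; the edges into `a₁` and into `v` are resolved UNCONDITIONALLY here: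

* `kprimeHolds_of_update_zero_a₁`: an unresolved edge from the root into `a₁`, pinned open, kills
  `Ω`; every mass of the form scales by `1 − p e` and the form by `(1 − p e)³`, so `(K′)` with the
  edge pinned closed gives `(K′)`;
* `kprimeHolds_of_update_zero_v`: an unresolved edge from the root into `v`, pinned open, kills
  `S`; the `S`-masses scale by `1 − p e` and the `N`-masses are unchanged by FLIP INVARIANCE, so
  the form scales by `(1 − p e)²`.

**Flip invariance** (`prob_update_one_eq_update_zero`): an event that, once the weight-`1` edges
of `p` are open, does not depend on the state of `e` has the same mass with `e` pinned open or
pinned closed (the involution `ω ↦ ω[e ↦ ¬ω e]` preserves the weight away from `e`).  For `N` and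
`X ∩ N` at an edge `{x, v}` with `x ∈ root` this is `OneEdge.conn_update_true_iff`: the only new
routes from `a₁` after opening the edge go through `x ∈ C₂` or through `v`.
-/

namespace Summit.Ventures.PercRepro2

namespace KPrime

variable {V : Type*} {E : Type*} [Fintype E] [DecidableEq E] [Fintype V] [DecidableEq V]
  {R : Type*} [Field R] [LinearOrder R] [IsStrictOrderedRing R]

/-! ## Resolving an edge at the root into `a₁`: the form is homogeneous -/

section StepA1

variable {ends : E → Sym2 V} {a₁ a₂ b v y : V} {p : E → R} {e : E}

omit [Fintype E] [Fintype V] [DecidableEq V] [IsStrictOrderedRing R] in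
/-- Pinning an unresolved edge keeps the weight-`1` edges of `p` open on the sure set. -/
lemma oneConfig_le_of_mem_sureSet_update (he : p e ≠ 1) {c : R} {ω : Config E}
    (hω : ω ∈ sureSet (Function.update p e c)) : oneConfig p ≤ ω := by
  intro f
  simp only [oneConfig]
  by_cases hf : p f = 1
  · have hfe : f ≠ e := fun h => he (h ▸ hf)
    have := hω.1 f (by rw [Function.update_of_ne hfe]; exact hf)
    simp [hf, this]
  · simp [hf]

omit [Fintype V] [DecidableEq V] [IsStrictOrderedRing R] in
/-- An event inside `Ω` is null once an edge from the root to `a₁` is pinned open. -/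
lemma prob_update_one_eq_zero_of_subset_Ω {x : V} (hends : ends e = s(x, a₁))
    (hx : x ∈ root p ends a₂) (he : p e ≠ 1) {A : Set (Config E)} (hA : A ⊆ Ω ends a₁ a₂) :
    prob (Function.update p e 1) A = 0 := by
  apply prob_eq_zero_of_inter_sureSet_eq_empty
  ext ω
  simp only [Set.mem_inter_iff, Set.mem_empty_iff_false, iff_false, not_and]
  intro hωA hω
  have h1 : ω e = true := hω.1 e (by simp)
  have hx' : Conn ends ω a₂ x := conn_mono (oneConfig_le_of_mem_sureSet_update he hω) hx
  have hxa : Conn ends ω x a₁ := conn_of_openAdj ⟨e, h1, hends⟩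
  exact (mem_Ω.1 (hA hωA)) (conn_symm (conn_trans hx' hxa))

omit [Fintype V] [DecidableEq V] [IsStrictOrderedRing R] in
/-- An event inside `Ω` has mass `(1 − p e)` times its mass with the root–`a₁` edge pinned closed. -/
lemma prob_eq_scale_of_subset_Ω {x : V} (hends : ends e = s(x, a₁)) (hx : x ∈ root p ends a₂)
    (he : p e ≠ 1) {A : Set (Config E)} (hA : A ⊆ Ω ends a₁ a₂) :
    prob p A = (1 - p e) * prob (Function.update p e 0) A := by
  rw [prob_eq_pin p A e, prob_update_one_eq_zero_of_subset_Ω hends hx he hA, mul_zero, zero_add]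

omit [Fintype E] [DecidableEq E] [Fintype V] [LinearOrder R] [IsStrictOrderedRing R] in
/-- `N ⊆ Ω`. -/
lemma N_subset_Ω : N ends a₁ a₂ v ⊆ Ω ends a₁ a₂ := fun _ hω => mem_Ω.2 (mem_N.1 hω).1

omit [Fintype E] [DecidableEq E] [Fintype V] [LinearOrder R] [IsStrictOrderedRing R] in
/-- The class `(0,1)` lies in `S`. -/
lemma cls01_subset_S : cls01 ends a₁ a₂ v y ⊆ S ends a₁ a₂ v := fun _ hω => hω.2

omit [Fintype E] [DecidableEq E] [Fintype V] [LinearOrder R] [IsStrictOrderedRing R] in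
/-- The glued class `(0,1)ᵉ` lies in `S`. -/
lemma cls01e_subset_S : cls01e ends a₁ a₂ b v y ⊆ S ends a₁ a₂ v := fun _ hω => hω.1.2

omit [Fintype V] in
/-- **Resolving an edge from the root into `a₁`**: `(K′)` with the edge pinned closed gives `(K′)`
(pinned open, `Ω` is null; every mass of the form scales by `1 − p e`, the form by `(1 − p e)³`). -/
theorem kprimeHolds_of_update_zero_a₁ (hp : IsProbVec p) {x : V} (hends : ends e = s(x, a₁))
    (hx : x ∈ root p ends a₂) (he : p e ≠ 1)
    (h0 : KPrimeHolds ends a₁ a₂ b v y (Function.update p e 0)) :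
    KPrimeHolds ends a₁ a₂ b v y p := by
  have sc : ∀ A : Set (Config E), A ⊆ Ω ends a₁ a₂ →
      prob p A = (1 - p e) * prob (Function.update p e 0) A :=
    fun A hA => prob_eq_scale_of_subset_Ω hends hx he hA
  have hSΩ : S ends a₁ a₂ v ⊆ Ω ends a₁ a₂ := S_subset_Ω
  unfold KPrimeHolds kprimeForm at h0 ⊢
  rw [sc _ Set.inter_subset_right, sc _ Set.inter_subset_right,
    sc _ (Set.inter_subset_right.trans hSΩ), sc _ hSΩ, sc _ (cls01e_subset_S.trans hSΩ),
    sc _ (cls01_subset_S.trans hSΩ), sc _ Set.inter_subset_right, sc _ Set.inter_subset_right,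
    sc _ (Set.inter_subset_right.trans N_subset_Ω), sc _ N_subset_Ω]
  have h1t : 0 ≤ 1 - p e := sub_nonneg.2 (hp.le_one e)
  have h3 : 0 ≤ (1 - p e) ^ 3 := pow_nonneg h1t 3
  nlinarith [mul_nonneg h3 h0]

end StepA1

/-! ## Flip invariance: an event that ignores the state of `e` on the sure part has the same mass with `e` pinned open or closed -/

section Flip

variable {p : E → R} {e : E}

/-- The flip of the edge `e`. -/
def flip (e : E) (ω : Config E) : Config E := Function.update ω e (!ω e)

omit [Fintype E] [Fintype V] [DecidableEq V] [LinearOrder R] [IsStrictOrderedRing R] [Field R] in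
/-- The flip is an involution. -/
lemma flip_flip (e : E) (ω : Config E) : flip e (flip e ω) = ω := by
  ext f
  by_cases h : f = e
  · subst h; simp [flip]
  · simp [flip, Function.update_of_ne h]

/-- The weight away from `e`. -/
def weightAway (p : E → R) (e : E) (ω : Config E) : R :=
  ∏ f ∈ Finset.univ.erase e, edgeFactor (p f) (ω f)

omit [Fintype V] [DecidableEq V] [LinearOrder R] [IsStrictOrderedRing R] in
/-- The weight away from `e` ignores the flip of `e`. -/
lemma weightAway_flip (ω : Config E) : weightAway p e (flip e ω) = weightAway p e ω :=
  prod_erase_update_right p ω e _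

omit [Fintype V] [DecidableEq V] [LinearOrder R] [IsStrictOrderedRing R] in
/-- With `e` pinned open the weight is the weight away from `e` on `{e open}`, `0` elsewhere. -/
lemma weight_update_one_eq (ω : Config E) :
    weight (Function.update p e 1) ω = weightAway p e ω * (if ω e = true then 1 else 0) := by
  rw [weight_eq_mul_edgeFactor _ ω e, prod_erase_update_left, Function.update_self]
  unfold weightAway
  cases ω e <;> simp [edgeFactor]

omit [Fintype V] [DecidableEq V] [LinearOrder R] [IsStrictOrderedRing R] in
/-- With `e` pinned closed the weight is the weight away from `e` on `{e closed}`, `0` elsewhere. -/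
lemma weight_update_zero_eq (ω : Config E) :
    weight (Function.update p e 0) ω = weightAway p e ω * (if ω e = true then 0 else 1) := by
  rw [weight_eq_mul_edgeFactor _ ω e, prod_erase_update_left, Function.update_self]
  unfold weightAway
  cases ω e <;> simp [edgeFactor]

omit [Fintype V] [DecidableEq V] [IsStrictOrderedRing R] in
/-- Off the weight-`1` edges of `p` (other than `e`) the weight away from `e` vanishes. -/
lemma weightAway_eq_zero_of_not_le (he : p e ≠ 1) {ω : Config E} (h : ¬ oneConfig p ≤ ω) :
    weightAway p e ω = 0 := by
  have : ∃ f, p f = 1 ∧ ω f = false := by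
    rw [Pi.le_def, not_forall] at h
    obtain ⟨f, hf⟩ := h
    refine ⟨f, ?_, ?_⟩
    · by_contra hpf
      exact hf (by simp [oneConfig, hpf])
    · by_contra hωf
      simp only [Bool.not_eq_false] at hωf
      exact hf (by simp [hωf])
  obtain ⟨f, hf, hωf⟩ := this
  have hfe : f ≠ e := fun h' => he (h' ▸ hf)
  unfold weightAway
  apply Finset.prod_eq_zero (Finset.mem_erase.2 ⟨hfe, Finset.mem_univ f⟩)
  simp [hf, hωf]

omit [Fintype V] [DecidableEq V] [IsStrictOrderedRing R] in
/-- **Flip invariance**: if, on the weight-`1` edges of `p` being open, the event `A` does not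
depend on the state of `e`, then its mass with `e` pinned open equals its mass with `e` pinned
closed. -/
theorem prob_update_one_eq_update_zero (he : p e ≠ 1) {A : Set (Config E)}
    (hA : ∀ ω : Config E, oneConfig p ≤ ω →
      (Function.update ω e true ∈ A ↔ Function.update ω e false ∈ A)) :
    prob (Function.update p e 1) A = prob (Function.update p e 0) A := by
  classical
  have hinv : Function.Involutive (flip e) := flip_flip e
  unfold prob
  have hsum := Equiv.sum_comp hinv.toPerm
    (fun ω => A.indicator (weight (Function.update p e 1)) ω)
  rw [← hsum]
  refine Finset.sum_congr rfl fun ω _ => ?_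
  simp only [Function.Involutive.coe_toPerm]
  rw [Set.indicator_apply, Set.indicator_apply, weight_update_one_eq, weight_update_zero_eq,
    weightAway_flip]
  have hfe : flip e ω e = !ω e := by simp [flip]
  by_cases hle : oneConfig p ≤ ω
  · have key : flip e ω ∈ A ↔ ω ∈ A := by
      cases hωe : ω e
      · have h1 : flip e ω = Function.update ω e true := by simp [flip, hωe]
        have h2 : ω = Function.update ω e false := by rw [← hωe, Function.update_eq_self]
        rw [h1]; conv_rhs => rw [h2]
        exact hA ω hle
      · have h1 : flip e ω = Function.update ω e false := by simp [flip, hωe]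
        have h2 : ω = Function.update ω e true := by rw [← hωe, Function.update_eq_self]
        rw [h1]; conv_rhs => rw [h2]
        exact (hA ω hle).symm
    rw [hfe]
    by_cases hωA : ω ∈ A
    · have h' := key.2 hωA
      cases ω e <;> simp [hωA, h']
    · have h' : flip e ω ∉ A := fun h => hωA (key.1 h)
      cases ω e <;> simp [hωA, h']
  · rw [weightAway_eq_zero_of_not_le he hle]
    simp

end Flip

/-! ## Resolving an edge at the root into `v`: `S` is killed, the `N`-masses are unchanged -/

section StepV

variable {ends : E → Sym2 V} {a₁ a₂ b v y : V} {p : E → R} {e : E}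

omit [Fintype E] [Fintype V] [DecidableEq V] [LinearOrder R] [IsStrictOrderedRing R] [Field R] in
/-- `ω[e ↦ closed] ≤ ω[e ↦ open]`. -/
lemma update_false_le_update_true' (ω : Config E) (e : E) :
    Function.update ω e false ≤ Function.update ω e true := by
  intro f
  by_cases h : f = e
  · subst h; simp
  · simp [Function.update_of_ne h]

omit [Fintype E] [DecidableEq E] [Fintype V] [LinearOrder R] [IsStrictOrderedRing R] in
/-- `N` is a decreasing event. -/
lemma N_anti {ω ω' : Config E} (h : ω ≤ ω') (hω' : ω' ∈ N ends a₁ a₂ v) : ω ∈ N ends a₁ a₂ v := by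
  rw [mem_N] at hω' ⊢
  exact ⟨fun hc => hω'.1 (conn_mono h hc), fun hc => hω'.2 (conn_mono h hc)⟩

omit [Fintype E] [Fintype V] [IsStrictOrderedRing R] in
/-- With `e = {x, v}`, `x ∈ root`, the weight-`1` edges open and `e` pinned closed: opening `e`
keeps `N` (the only new routes from `a₁` go through `x ∈ C₂` or through `v`). -/
lemma update_true_mem_N {x : V} (hends : ends e = s(x, v)) (hx : x ∈ root p ends a₂)
    (he : p e ≠ 1) {ω : Config E} (hle : oneConfig p ≤ ω)
    (hω : Function.update ω e false ∈ N ends a₁ a₂ v) : Function.update ω e true ∈ N ends a₁ a₂ v := by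
  set ω' := Function.update ω e false with hω'
  have hle' : oneConfig p ≤ ω' := by
    intro f
    by_cases hf : f = e
    · subst hf; simp [hω', oneConfig, he]
    · simp only [hω', Function.update_of_ne hf]; exact hle f
  have hx' : Conn ends ω' a₂ x := conn_mono hle' hx
  have heq : Function.update ω e true = Function.update ω' e true := by
    simp [hω', Function.update_idem]
  rw [heq, mem_N, OneEdge.conn_update_true_iff hends, OneEdge.conn_update_true_iff hends]
  rw [mem_N] at hω
  refine ⟨?_, ?_⟩
  · rintro (h | ⟨h1, _⟩ | ⟨h1, _⟩)
    · exact hω.1 h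
    · exact hω.1 (conn_trans h1 (conn_symm hx'))
    · exact hω.2 h1
  · rintro (h | ⟨h1, _⟩ | ⟨h1, _⟩)
    · exact hω.2 h
    · exact hω.1 (conn_trans h1 (conn_symm hx'))
    · exact hω.2 h1

omit [Fintype E] [Fintype V] [IsStrictOrderedRing R] in
/-- Flip invariance of `N` at an edge from the root into `v`. -/
lemma N_flip_invariant {x : V} (hends : ends e = s(x, v)) (hx : x ∈ root p ends a₂)
    (he : p e ≠ 1) (ω : Config E) (hle : oneConfig p ≤ ω) :
    (Function.update ω e true ∈ N ends a₁ a₂ v ↔ Function.update ω e false ∈ N ends a₁ a₂ v) :=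
  ⟨fun h => N_anti (update_false_le_update_true' ω e) h, update_true_mem_N hends hx he hle⟩

omit [Fintype E] [Fintype V] [IsStrictOrderedRing R] in
/-- Flip invariance of `X ∩ N` at an edge from the root into `v`. -/
lemma XN_flip_invariant {x : V} (hends : ends e = s(x, v)) (hx : x ∈ root p ends a₂)
    (he : p e ≠ 1) (ω : Config E) (hle : oneConfig p ≤ ω) :
    (Function.update ω e true ∈ connEvent ends a₁ b ∩ N ends a₁ a₂ v ↔
      Function.update ω e false ∈ connEvent ends a₁ b ∩ N ends a₁ a₂ v) := by
  set ω' := Function.update ω e false with hω'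
  have heq : Function.update ω e true = Function.update ω' e true := by
    simp [hω', Function.update_idem]
  have hN := N_flip_invariant (a₁ := a₁) hends hx he ω hle
  rw [heq] at hN ⊢
  simp only [Set.mem_inter_iff, mem_connEvent]
  constructor
  · rintro ⟨hb, hN'⟩
    have hN'' : ω' ∈ N ends a₁ a₂ v := hN.1 hN'
    refine ⟨?_, hN''⟩
    rw [OneEdge.conn_update_true_iff hends] at hb
    rcases hb with h | ⟨h1, _⟩ | ⟨h1, _⟩
    · exact h
    · exfalso
      have hle' : oneConfig p ≤ ω' := by
        intro f
        by_cases hf : f = e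
        · subst hf; simp [hω', oneConfig, he]
        · simp only [hω', Function.update_of_ne hf]; exact hle f
      exact (mem_N.1 hN'').1 (conn_trans h1 (conn_symm (conn_mono hle' hx)))
    · exact absurd h1 (mem_N.1 hN'').2
  · rintro ⟨hb, hN'⟩
    exact ⟨conn_mono (OneEdge.le_update_true ω' e) hb, hN.2 hN'⟩

omit [Fintype V] [IsStrictOrderedRing R] in
/-- An event inside `S` is null once an edge from the root to `v` is pinned open. -/
lemma prob_update_one_eq_zero_of_subset_S {x : V} (hends : ends e = s(x, v))
    (hx : x ∈ root p ends a₂) (he : p e ≠ 1) {A : Set (Config E)} (hA : A ⊆ S ends a₁ a₂ v) :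
    prob (Function.update p e 1) A = 0 := by
  apply prob_eq_zero_of_inter_sureSet_eq_empty
  ext ω
  simp only [Set.mem_inter_iff, Set.mem_empty_iff_false, iff_false, not_and]
  intro hωA hω
  have h1 : ω e = true := hω.1 e (by simp)
  have hx' : Conn ends ω a₂ x := conn_mono (oneConfig_le_of_mem_sureSet_update he hω) hx
  have hxv : Conn ends ω x v := conn_of_openAdj ⟨e, h1, hends⟩
  exact (mem_S.1 (hA hωA)).2 (conn_trans hx' hxv)

omit [Fintype V] [IsStrictOrderedRing R] in
/-- An event inside `S` has mass `(1 − p e)` times its mass with the root–`v` edge pinned closed. -/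
lemma prob_eq_scale_of_subset_S {x : V} (hends : ends e = s(x, v)) (hx : x ∈ root p ends a₂)
    (he : p e ≠ 1) {A : Set (Config E)} (hA : A ⊆ S ends a₁ a₂ v) :
    prob p A = (1 - p e) * prob (Function.update p e 0) A := by
  rw [prob_eq_pin p A e, prob_update_one_eq_zero_of_subset_S hends hx he hA, mul_zero, zero_add]

omit [Fintype V] [DecidableEq V] [IsStrictOrderedRing R] in
/-- A flip-invariant event has the same mass under `p` and with `e` pinned closed. -/
lemma prob_eq_of_flip_invariant {A : Set (Config E)} (he : p e ≠ 1)
    (hA : ∀ ω : Config E, oneConfig p ≤ ω →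
      (Function.update ω e true ∈ A ↔ Function.update ω e false ∈ A)) :
    prob p A = prob (Function.update p e 0) A := by
  rw [prob_eq_pin p A e, prob_update_one_eq_update_zero he hA]
  ring

omit [Fintype V] in
/-- **Resolving an edge from the root into `v`**: `(K′)` with the edge pinned closed gives `(K′)`
(pinned open, `S` is null; the `S`-masses scale by `1 − p e`, the `N`-masses are unchanged by flip
invariance; the form scales by `(1 − p e)²`). -/
theorem kprimeHolds_of_update_zero_v (hp : IsProbVec p) {x : V} (hends : ends e = s(x, v))
    (hx : x ∈ root p ends a₂) (he : p e ≠ 1)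
    (h0 : KPrimeHolds ends a₁ a₂ b v y (Function.update p e 0)) :
    KPrimeHolds ends a₁ a₂ b v y p := by
  have sc : ∀ A : Set (Config E), A ⊆ S ends a₁ a₂ v →
      prob p A = (1 - p e) * prob (Function.update p e 0) A :=
    fun A hA => prob_eq_scale_of_subset_S hends hx he hA
  have hUΩ : connEvent ends a₁ v ∩ Ω ends a₁ a₂ ⊆ S ends a₁ a₂ v := by
    rw [U_inter_Ω_eq]; exact Set.inter_subset_right
  have hN : prob p (N ends a₁ a₂ v) = prob (Function.update p e 0) (N ends a₁ a₂ v) :=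
    prob_eq_of_flip_invariant he (N_flip_invariant hends hx he)
  have hXN : prob p (connEvent ends a₁ b ∩ N ends a₁ a₂ v) =
      prob (Function.update p e 0) (connEvent ends a₁ b ∩ N ends a₁ a₂ v) :=
    prob_eq_of_flip_invariant he (XN_flip_invariant hends hx he)
  unfold KPrimeHolds kprimeForm at h0 ⊢
  have s1 : connEvent ends a₁ v ∩ connEvent ends a₁ b ∩ Ω ends a₁ a₂ ⊆ S ends a₁ a₂ v := by
    intro ω hω; exact hUΩ ⟨hω.1.1, hω.2⟩
  have s7 : connEvent ends a₁ v ∩ connEvent ends a₂ y ∩ connEvent ends a₁ b ∩ Ω ends a₁ a₂ ⊆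
      S ends a₁ a₂ v := by
    intro ω hω; exact hUΩ ⟨hω.1.1.1, hω.2⟩
  have s8 : connEvent ends a₁ v ∩ connEvent ends a₂ y ∩ Ω ends a₁ a₂ ⊆ S ends a₁ a₂ v := by
    intro ω hω; exact hUΩ ⟨hω.1.1, hω.2⟩
  rw [sc _ s1, sc _ hUΩ, sc _ Set.inter_subset_right, sc _ (subset_refl _), sc _ cls01e_subset_S,
    sc _ cls01_subset_S, sc _ s7, sc _ s8, hN, hXN]
  have h1t : 0 ≤ 1 - p e := sub_nonneg.2 (hp.le_one e)
  have h2 : 0 ≤ (1 - p e) ^ 2 := pow_nonneg h1t 2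
  nlinarith [mul_nonneg h2 h0]

end StepV

end KPrime

end Summit.Ventures.PercRepro2
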